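import Summits.ResolutionOfSingularities.ResolutionOfSingularities.Theorems.EquisingularLiftEquisingularLiftOrdinaryPointsMatrixForm
import Summits.ResolutionOfSingularities.ResolutionOfSingularities.Theorems.EquisingularLiftEquisingularLiftNatSubmaxLinNResidual
import Summits.ResolutionOfSingularities.ResolutionOfSingularities.Theorems.EquisingularLiftEquisingularLiftNatSubmaxLineLinSubst
import HarnessLib

/-!
# The honest residuals of `EquisingularLiftNat` (stmt-…-20038, every `n`) and `EquisingularLiftNatThree` (stmt-…-20148) RE-CUT BY NAME with the
# CLASSIFICATION-FREE ordinary-points family: «the singular points are finitely many ORDINARY MULTIPLE POINTS IN LINEARLY GENERAL POSITION»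

[OURS · leafhand-res-equisingularlift-7 g1, 2026-08-31; cell `pub/decomp-res`; items stmt-…-20038 / -20148] AI-produced, weaker than expert review; NOT a
statement of any manuscript; nothing here proves resolution of singularities.  DEF-FREE; no `sorry`; standard axioms; ZERO named hypotheses; pure reduction
over ✓ `SubmaxLinN.equisingularLiftNat_of_forall_elnatO_off_submaxLinN` (p823304), ✓ `SubmaxLine.equisingularLiftNatThree_of_forall_elnatO_off_submaxLine`
(p822516) and ✓ `MultiOrd.elNatAt_of_ordinaryPoints_matrix` (this generation, matrix form with INTRINSIC hypotheses).

* ★ `MultiOrd.equisingularLiftNat_of_forall_elnatO_off_submaxLinN_ordinaryPointsMatrix` (every `n`) and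
  ★ `MultiOrd.equisingularLiftNatThree_of_forall_elnatO_off_submaxLine_ordinaryPointsMatrix` (`n = 3`): the route decls hold BY NAME as soon as
  `ELNatConclusionO` is known for the non-regular integral `H = V₊(F)` (`F` a prime form of degree `e ≥ 3`) with no submaximal codimension-2 linear subspace
  AND such that for every invertible matrix `B` and duplicate-free marking `S` with `B_{cc} = 1` whose marked columns are ORDINARY MULTIPLE POINTS of `F`
  (translated charts `Φ_c + Ψ_c`, `Φ_c` nonsingular in the classical closed-point sense), some singular point of `V₊(F)` is NOT proportional to a marked
  column.  In words: the residual consists of the `H` having a NON-ORDINARY singular point, or infinitely many / linearly dependent singular points.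

Honest reading: closes no registered stub; for `n ≥ 4` the residual still contains the summit; for cubic surfaces the residual is the non-`A₁` normal cubics
(given the classical, unformalised fact that `≤ 4` nodes are in general position).
-/

set_option linter.dupNamespace false -- mandated namespace `Summit.<Summit>.<Problem>` of this single-conjunct summit

noncomputable section

open CategoryTheory CategoryTheory.Limits AlgebraicGeometry TopologicalSpace
open MvPolynomial
open Literature.AlgebraicGeometry.Resolution
open Literature.AlgebraicGeometry.Motives Literature.AlgebraicGeometry.Motives.SmoothHypersurface
open Literature.AlgebraicGeometry.Motives.ProjectiveSpace

namespace Summit.ResolutionOfSingularities.ResolutionOfSingularities.Cruxes.EquisingularLiftNat.Sections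

namespace MultiOrd

/-- ★ **`EquisingularLiftNat` (stmt-…-20038) from `ELNatConclusionO` off the submaximal codimension-2 linear subspaces AND off the hypersurfaces whose
singular points are ordinary multiple points in linearly general position (matrix form, intrinsic data)** — every dimension, every characteristic.
[OURS · lh7 g1 · DEF-FREE · pure reduction] [cite: Hartshorne1977, I Thm. 5.1, I Ex. 5.12] -/
theorem equisingularLiftNat_of_forall_elnatO_off_submaxLinN_ordinaryPointsMatrix
    (h : ∀ p : ℕ, p.Prime → ∀ (k : Type) [Field k] [CharP k p] [IsAlgClosed k] (n : ℕ) (H : Scheme.{0})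
      (ι : H ⟶ (Literature.AlgebraicGeometry.Motives.projectiveSpace n k).left), IsClosedImmersion ι → IsIntegral H →
      (∀ y : (Literature.AlgebraicGeometry.Motives.projectiveSpace n k).left,
        ∃ U : (Literature.AlgebraicGeometry.Motives.projectiveSpace n k).left.affineOpens,
          y ∈ (U : (Literature.AlgebraicGeometry.Motives.projectiveSpace n k).left.Opens) ∧ (ι.ker.ideal U).IsPrincipal) →
      3 ≤ n → ¬ Scheme.IsRegular H → ∀ (e : ℕ) (F : MvPolynomial (Fin (n + 1)) k), 3 ≤ e → F.IsHomogeneous e → Prime F →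
      (letI := MvPolynomial.gradedAlgebra (σ := Fin (n + 1)) (R := k)
       Set.range ι = {x : Proj (homogeneousSubmodule (Fin (n + 1)) k) | F ∈ x.asHomogeneousIdeal}) →
      (∀ (τ τ' : Fin (n + 1) → MvPolynomial (Fin (n + 1)) k) (d : ℕ),
        (∀ i, (τ i).IsHomogeneous 1) → (∀ i, (τ' i).IsHomogeneous 1) → (∀ i, aeval τ (τ' i) = X i) → (∀ i, aeval τ' (τ i) = X i) →
        (aeval τ' F).IsHomogeneous (d + 2) →
        aeval τ' F ∉ (Ideal.span {(X ⟨n - 1, by omega⟩ : MvPolynomial (Fin (n + 1)) k), X ⟨n, by omega⟩}) ^ (d + 1)) →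
      (∀ (B : Matrix (Fin (n + 1)) (Fin (n + 1)) k) (S : List (Fin (n + 1))), IsUnit B.det → S.Nodup → (∀ c ∈ S, B c c = 1) →
        (∀ c ∈ S, ∃ (μ : ℕ) (Φ Ψ : MvPolynomial (Fin n) k), 1 ≤ μ ∧ Φ.IsHomogeneous μ ∧
          (∀ z : Fin n → k, z ≠ 0 → eval z Φ = 0 → ∃ j, eval z (pderiv j Φ) ≠ 0) ∧
          Ψ ∈ Ideal.span (Set.range (X : Fin n → MvPolynomial (Fin n) k)) ^ (μ + 1) ∧
          aeval (fun j : Fin n => (X j : MvPolynomial (Fin n) k) + C (B (c.succAbove j) c)) (ProjectiveSpace.dehomogenize k c F) = Φ + Ψ) →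
        ∃ b : Fin (n + 1) → k, b ≠ 0 ∧ eval b F = 0 ∧ (∀ j, eval b (pderiv j F) = 0) ∧ ∀ c ∈ S, ∀ s : k, b ≠ s • fun l => B l c) →
      ELNatConclusionO k n H ι) :
    Summit.ResolutionOfSingularities.ResolutionOfSingularities.Theses.EquisingularLift.EquisingularLiftNat := by
  refine SubmaxLinN.equisingularLiftNat_of_forall_elnatO_off_submaxLinN ?_
  intro p hp k _ _ _ n H ι hι hH hloc hn hreg e F he hF hprime hrange hsubmax
  obtain ⟨r, rfl⟩ : ∃ r, n = r + 1 + 1 := ⟨n - 2, by omega⟩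
  by_cases hex : ∃ (B : Matrix (Fin (r + 1 + 1 + 1)) (Fin (r + 1 + 1 + 1)) k) (S : List (Fin (r + 1 + 1 + 1))),
      IsUnit B.det ∧ S.Nodup ∧ (∀ c ∈ S, B c c = 1) ∧
      (∀ c ∈ S, ∃ (μ : ℕ) (Φ Ψ : MvPolynomial (Fin (r + 1 + 1)) k), 1 ≤ μ ∧ Φ.IsHomogeneous μ ∧
        (∀ z : Fin (r + 1 + 1) → k, z ≠ 0 → eval z Φ = 0 → ∃ j, eval z (pderiv j Φ) ≠ 0) ∧
        Ψ ∈ Ideal.span (Set.range (X : Fin (r + 1 + 1) → MvPolynomial (Fin (r + 1 + 1)) k)) ^ (μ + 1) ∧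
        aeval (fun j : Fin (r + 1 + 1) => (X j : MvPolynomial (Fin (r + 1 + 1)) k) + C (B (c.succAbove j) c))
          (ProjectiveSpace.dehomogenize k c F) = Φ + Ψ) ∧
      (∀ b : Fin (r + 1 + 1 + 1) → k, b ≠ 0 → eval b F = 0 → (∀ j, eval b (pderiv j F) = 0) → ∃ c ∈ S, ∃ s : k, b = s • fun l => B l c)
  · obtain ⟨B, S, hB, hS, hB1, hord, hjac⟩ := hex
    haveI := hι
    have hord' : ∀ c ∈ S, ∃ (μ : ℕ) (Φ Ψ : MvPolynomial (Fin (r + 2)) k), 1 ≤ μ ∧ Φ.IsHomogeneous μ ∧ IsNonsingularForm k Φ ∧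
        Ψ ∈ Ideal.span (Set.range (X : Fin (r + 2) → MvPolynomial (Fin (r + 2)) k)) ^ (μ + 1) ∧
        aeval (fun j : Fin (r + 2) => (X j : MvPolynomial (Fin (r + 2)) k) + C (B (c.succAbove j) c)) (ProjectiveSpace.dehomogenize k c F) = Φ + Ψ :=
      fun c hc => by
        obtain ⟨μ, Φ, Ψ, h1, h2, h3, h4, h5⟩ := hord c hc
        exact ⟨μ, Φ, Ψ, h1, h2, isNonsingularForm_of_forall_exists_eval_pderiv_ne_zero h3, h4, h5⟩
    exact RouteCurrency.elnatO_of_elNatAt p hp k (r + 1 + 1) H ι hι hH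
      (elNatAt_of_ordinaryPoints_matrix p hp ι F hF hprime hrange B hB S hS hB1 hord' hjac)
  · refine h p hp k (r + 1 + 1) H ι hι hH hloc hn hreg e F he hF hprime hrange hsubmax fun B S hB hS hB1 hord => ?_
    by_contra hno
    refine hex ⟨B, S, hB, hS, hB1, hord, fun b hb h0 hpart => ?_⟩
    by_contra hc
    push Not at hc
    exact hno ⟨b, hb, h0, hpart, hc⟩

/-- ★ **`EquisingularLiftNatThree` (stmt-…-20148) RE-CUT BY NAME off the submaximal-line surfaces AND off the surfaces whose singular points are ordinary
multiple points in linearly general position (matrix form, intrinsic data).** [OURS · lh7 g1 · DEF-FREE] [cite: Hartshorne1977, I Thm. 5.1, I Ex. 5.12] -/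
theorem equisingularLiftNatThree_of_forall_elnatO_off_submaxLine_ordinaryPointsMatrix
    (h : ∀ p : ℕ, p.Prime → ∀ (k : Type) [Field k] [CharP k p] [IsAlgClosed k] (H : Scheme.{0})
      (ι : H ⟶ (Literature.AlgebraicGeometry.Motives.projectiveSpace 3 k).left), IsClosedImmersion ι → IsIntegral H →
      (∀ y : (Literature.AlgebraicGeometry.Motives.projectiveSpace 3 k).left,
        ∃ U : (Literature.AlgebraicGeometry.Motives.projectiveSpace 3 k).left.affineOpens,
          y ∈ (U : (Literature.AlgebraicGeometry.Motives.projectiveSpace 3 k).left.Opens) ∧ (ι.ker.ideal U).IsPrincipal) →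
      ¬ Scheme.IsRegular H → ∀ (e : ℕ) (F : MvPolynomial (Fin (3 + 1)) k), 3 ≤ e → F.IsHomogeneous e → Prime F →
      (letI := MvPolynomial.gradedAlgebra (σ := Fin (3 + 1)) (R := k)
       Set.range ι = {x : Proj (homogeneousSubmodule (Fin (3 + 1)) k) | F ∈ x.asHomogeneousIdeal}) →
      (∀ (τ τ' : Fin (3 + 1) → MvPolynomial (Fin (3 + 1)) k) (d : ℕ) (A B C : MvPolynomial (Fin 2) k),
        (∀ i, (τ i).IsHomogeneous 1) → (∀ i, (τ' i).IsHomogeneous 1) → (∀ i, aeval τ (τ' i) = X i) → (∀ i, aeval τ' (τ i) = X i) →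
        A.IsHomogeneous (d + 1) → B.IsHomogeneous (d + 1) → C.IsHomogeneous (d + 2) →
        aeval τ' F ≠ X 0 * rename (![2, 3] : Fin 2 → Fin (3 + 1)) A + X 1 * rename (![2, 3] : Fin 2 → Fin (3 + 1)) B +
          rename (![2, 3] : Fin 2 → Fin (3 + 1)) C) →
      (∀ (B : Matrix (Fin (3 + 1)) (Fin (3 + 1)) k) (S : List (Fin (3 + 1))), IsUnit B.det → S.Nodup → (∀ c ∈ S, B c c = 1) →
        (∀ c ∈ S, ∃ (μ : ℕ) (Φ Ψ : MvPolynomial (Fin 3) k), 1 ≤ μ ∧ Φ.IsHomogeneous μ ∧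
          (∀ z : Fin 3 → k, z ≠ 0 → eval z Φ = 0 → ∃ j, eval z (pderiv j Φ) ≠ 0) ∧
          Ψ ∈ Ideal.span (Set.range (X : Fin 3 → MvPolynomial (Fin 3) k)) ^ (μ + 1) ∧
          aeval (fun j : Fin 3 => (X j : MvPolynomial (Fin 3) k) + C (B (c.succAbove j) c)) (ProjectiveSpace.dehomogenize k c F) = Φ + Ψ) →
        ∃ b : Fin (3 + 1) → k, b ≠ 0 ∧ eval b F = 0 ∧ (∀ j, eval b (pderiv j F) = 0) ∧ ∀ c ∈ S, ∀ s : k, b ≠ s • fun l => B l c) →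
      ELNatConclusionO k 3 H ι) :
    Summit.ResolutionOfSingularities.ResolutionOfSingularities.Theses.EquisingularLift.EquisingularLiftNatThree := by
  refine SubmaxLine.equisingularLiftNatThree_of_forall_elnatO_off_submaxLine ?_
  intro p hp k _ _ _ H ι hι hH hloc hreg e F he hF hprime hrange hsubmax
  by_cases hex : ∃ (B : Matrix (Fin (1 + 1 + 1 + 1)) (Fin (1 + 1 + 1 + 1)) k) (S : List (Fin (1 + 1 + 1 + 1))),
      IsUnit B.det ∧ S.Nodup ∧ (∀ c ∈ S, B c c = 1) ∧
      (∀ c ∈ S, ∃ (μ : ℕ) (Φ Ψ : MvPolynomial (Fin (1 + 1 + 1)) k), 1 ≤ μ ∧ Φ.IsHomogeneous μ ∧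
        (∀ z : Fin (1 + 1 + 1) → k, z ≠ 0 → eval z Φ = 0 → ∃ j, eval z (pderiv j Φ) ≠ 0) ∧
        Ψ ∈ Ideal.span (Set.range (X : Fin (1 + 1 + 1) → MvPolynomial (Fin (1 + 1 + 1)) k)) ^ (μ + 1) ∧
        aeval (fun j : Fin (1 + 1 + 1) => (X j : MvPolynomial (Fin (1 + 1 + 1)) k) + C (B (c.succAbove j) c))
          (ProjectiveSpace.dehomogenize k c F) = Φ + Ψ) ∧
      (∀ b : Fin (1 + 1 + 1 + 1) → k, b ≠ 0 → eval b F = 0 → (∀ j, eval b (pderiv j F) = 0) → ∃ c ∈ S, ∃ s : k, b = s • fun l => B l c)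
  · obtain ⟨B, S, hB, hS, hB1, hord, hjac⟩ := hex
    haveI := hι
    have hord' : ∀ c ∈ S, ∃ (μ : ℕ) (Φ Ψ : MvPolynomial (Fin (1 + 2)) k), 1 ≤ μ ∧ Φ.IsHomogeneous μ ∧ IsNonsingularForm k Φ ∧
        Ψ ∈ Ideal.span (Set.range (X : Fin (1 + 2) → MvPolynomial (Fin (1 + 2)) k)) ^ (μ + 1) ∧
        aeval (fun j : Fin (1 + 2) => (X j : MvPolynomial (Fin (1 + 2)) k) + C (B (c.succAbove j) c)) (ProjectiveSpace.dehomogenize k c F) = Φ + Ψ :=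
      fun c hc => by
        obtain ⟨μ, Φ, Ψ, h1, h2, h3, h4, h5⟩ := hord c hc
        exact ⟨μ, Φ, Ψ, h1, h2, isNonsingularForm_of_forall_exists_eval_pderiv_ne_zero h3, h4, h5⟩
    exact RouteCurrency.elnatO_of_elNatAt p hp k (1 + 1 + 1) H ι hι hH
      (elNatAt_of_ordinaryPoints_matrix (m := 1) p hp ι F hF hprime hrange B hB S hS hB1 hord' hjac)
  · refine h p hp k H ι hι hH hloc hreg e F he hF hprime hrange hsubmax fun B S hB hS hB1 hord => ?_
    by_contra hno
    refine hex ⟨B, S, hB, hS, hB1, hord, fun b hb h0 hpart => ?_⟩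
    by_contra hc
    push Not at hc
    exact hno ⟨b, hb, h0, hpart, hc⟩

end MultiOrd

end Summit.ResolutionOfSingularities.ResolutionOfSingularities.Cruxes.EquisingularLiftNat.Sections

end
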